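import Literature.Computability.MetaComplexity.AndProductSpanLowerBound
import Mathlib.LinearAlgebra.Span.Basic
import Mathlib.Algebra.CharP.Basic
import HarnessLib

/-!
# Linear relations among `ℤ₃ⁿ`-characters restricted to the Boolean cube: the triad kernel

Topic `Literature/Computability/MetaComplexity` (next to `AndProductSpanLowerBound`, whose product
functions `ProductSpan.prodFn` we use).  Let `F` be a field containing an element `ω` with
`ω² + ω + 1 = 0`, `ω ≠ 1` (a primitive cube root of unity; `ω ≠ 1` is automatic unless
`char F = 3`, and in characteristic `2` — the case `𝔽₄ ∋ ω` of the cell qa-qnc0 — it is free: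
`ker_cubeEval_eq_span_triad_of_charTwo`).  For `u ∈ (ℤ/3)ⁿ` the character `x ↦ ω^{⟨u,x⟩}` of
`(ℤ/3)ⁿ` restricted to the cube `{0,1}ⁿ` is the product function
`Q[u](y) = Π_{i : y_i = 1} ω^{u_i} = prodFn (charVec ω u) y`.  The `F`-linear map

  `cubeEval ω n : ((ℤ/3)ⁿ → F) → ({0,1}ⁿ → F)`,  `a ↦ (y ↦ Σ_u a(u)·Q[u](y))`

("evaluate the group-algebra element `Σ_u a(u)[u] ∈ F[(ℤ/3)ⁿ]` on the cube") is surjective with a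
kernel of dimension `3ⁿ − 2ⁿ`; **the kernel is spanned by the TRIADS**
`triad ω u i = Σ_{s ∈ ℤ/3} ω^{s}·[u + s·e_i]` (`ker_cubeEval_eq_span_triad`).  Equivalently: a
linear relation `Σ_j a_j Q[w_j] ≡ 0` on `{0,1}ⁿ` forces the coefficient vector
`u ↦ Σ_{j : w_j = u} a_j` to be a combination of triads (`fiberCoeff_mem_span_triad_of_rel`), and
every coefficient vector has a UNIQUE normal form supported on `{0,1}`-valued `u` modulo triads
(`isCompl_span_triad_boolSupp`).

In print this is the `d`-free part of Alon's Combinatorial Nullstellensatz, Theorem 1.1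
[Alon1999, Thm 1.1]: a polynomial vanishing on a grid `S₁ × ⋯ × S_n` lies in the ideal generated by
the `g_i = Π_{s ∈ S_i}(z_i − s)`; here the grid is `{1, ω}ⁿ ⊂ Fⁿ` (the image of the cube under
`y ↦ (ω^{y_i})_i`), `F[(ℤ/3)ⁿ] = F[z]/(z_i³ − 1)`, and `g_i = (z_i − 1)(z_i − ω)
= ω²·(1 + ω z_i + ω² z_i²)` is `ω²` times the triad at coordinate `i` (while `z_i³ − 1 =
g_i·(z_i − ω²)` already lies in the ideal).  The group-algebra / character form with its linear-
algebra proof is supplied here (asked by the cell qa-qnc0, planner qa-qnc0-p1 ROUND-33 §1, ask W-35c,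
2026-08-29: "TRIAD KERNEL … the source of rigidity" of exact fibres).

**Proof.** (1) Triads lie in the kernel: at a point `y`, the `i`-th factor of `Q[u + s e_i](y)` is
`ω^{(u_i+s)}` or `1`, and `Σ_s ω^s = Σ_s ω^{s}ω^{u_i+s} = 0` (`1 + ω + ω² = 0`, `ω³ = 1`).
(2) Modulo triads every basis vector `[v]` reduces to the span `B` of the `[u]` with `u ∈ {0,1}ⁿ`:
if `v_i = 2` then `[v] = ω·triad(v[i↦0], i) − ω·[v[i↦0]] − ω²·[v[i↦1]]` (induction on the number
of coordinates equal to `2`); so `span(triads) ⊔ B = ⊤`.  (3) `cubeEval` is injective on `B`: for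
`v₀ ∈ {0,1}ⁿ` the functional `Λ_{v₀}(g) = Σ_y (Π_i λ_{v₀ i}(y_i))·g(y)` with one-coordinate weights
`λ₁ = (true ↦ 1, false ↦ −1)` and `λ₀ = (true ↦ −1, false ↦ ω)` factorises on product functions,
`Λ_{v₀}(Q[u]) = Π_i (±(ω^{u_i} − 1) or ω − ω^{u_i})`, which for `u ∈ {0,1}ⁿ` vanishes unless
`u = v₀` and equals `(ω − 1)ⁿ ≠ 0` at `u = v₀`; hence `cubeEval a = 0` with `a ∈ B` gives `a = 0`.
(1)–(3) give `ker = span(triads)` and `IsCompl (span triads) B`.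

## References
* [Alon1999] N. Alon, *Combinatorial Nullstellensatz*, Combin. Probab. Comput. 8 (1999) 7–29,
  Theorem 1.1 (ideal of polynomials vanishing on a grid) — the instance grid `{1, ω}ⁿ` in the group
  algebra `F[(ℤ/3)ⁿ]`, stated for characters restricted to the Boolean cube, is supplied here.
-/

namespace Literature.Computability.MetaComplexity

namespace ProductSpan

open Finset

variable {F : Type*} [Field F]

section CubeCharacters

variable (ω : F) {n : ℕ}

/-! ### §1 Characters on the cube and the evaluation map -/

/-- The character pattern of `u ∈ (ℤ/3)ⁿ` as a vector of ring elements, `i ↦ ω^{u_i}`; the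
restricted character is `Q[u] = prodFn (charVec ω u)`, `Q[u](y) = Π_{i : y_i} ω^{u_i} = ω^{⟨u, y⟩}`.
[cite: Alon1999, Thm 1.1 — character/group-algebra instance supplied here] -/
def charVec (u : Fin n → ZMod 3) : Fin n → F := fun i => ω ^ (u i).val

/-- `Q[u](y) = ω^{Σ_{i : y_i} u_i}`.
[cite: Alon1999, Thm 1.1 — character/group-algebra instance supplied here] -/
theorem prodFn_charVec_eq_pow_sum (u : Fin n → ZMod 3) (y : Fin n → Bool) :
    prodFn (charVec ω u) y = ω ^ (∑ i, if y i then (u i).val else 0) := by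
  unfold prodFn charVec
  rw [← prod_pow_eq_pow_sum]
  exact prod_congr rfl fun i _ => by by_cases h : y i <;> simp [h]

/-- **The cube-evaluation map** `a ↦ (y ↦ Σ_u a(u)·Q[u](y))` from coefficient vectors on `(ℤ/3)ⁿ`
(the group algebra `F[(ℤ/3)ⁿ]` as an `F`-vector space) to functions on the cube `{0,1}ⁿ`.
[cite: Alon1999, Thm 1.1 — character/group-algebra instance supplied here] -/
def cubeEval (n : ℕ) : ((Fin n → ZMod 3) → F) →ₗ[F] ((Fin n → Bool) → F) where
  toFun a := fun y => ∑ u, a u * prodFn (charVec ω u) y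
  map_add' a b := by
    funext y
    simp only [Pi.add_apply, add_mul, sum_add_distrib]
  map_smul' c a := by
    funext y
    simp only [Pi.smul_apply, smul_eq_mul, RingHom.id_apply, mul_sum, mul_assoc]

/-- Unfolding `cubeEval`.
[cite: Alon1999, Thm 1.1 — character/group-algebra instance supplied here] -/
theorem cubeEval_apply (a : (Fin n → ZMod 3) → F) (y : Fin n → Bool) :
    cubeEval ω n a y = ∑ u, a u * prodFn (charVec ω u) y := rfl

/-- The basis vector `[v]` evaluates to the character `Q[v]`.
[cite: Alon1999, Thm 1.1 — character/group-algebra instance supplied here] -/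
theorem cubeEval_single (v : Fin n → ZMod 3) (y : Fin n → Bool) :
    cubeEval ω n (Pi.single v 1) y = prodFn (charVec ω v) y := by
  rw [cubeEval_apply, sum_eq_single_of_mem v (mem_univ v)]
  · simp
  · intro u _ huv
    simp [huv]

/-! ### §2 Triads -/

/-- **The triad** based at `u` in direction `i`: `Σ_{s ∈ ℤ/3} ω^{s}·[u + s·e_i]`.
[cite: Alon1999, Thm 1.1 (the generator `(z_i − 1)(z_i − ω)` of the grid ideal, up to the unit `ω²`) — character form supplied here] -/
def triad (u : Fin n → ZMod 3) (i : Fin n) : (Fin n → ZMod 3) → F :=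
  Pi.single u (1 : F) + ω • Pi.single (Function.update u i (u i + 1)) (1 : F)
    + ω ^ 2 • Pi.single (Function.update u i (u i + 2)) (1 : F)

/-- The span of all triads `triad ω u i` (`u ∈ (ℤ/3)ⁿ`, `i : Fin n`) — the "triad ideal" of the cube.
[cite: Alon1999, Thm 1.1 (the ideal generated by the `g_i`) — character form supplied here] -/
abbrev triadSpan (n : ℕ) : Submodule F ((Fin n → ZMod 3) → F) :=
  Submodule.span F (Set.range fun p : (Fin n → ZMod 3) × Fin n => triad ω p.1 p.2)

/-- `ω³ = 1` from `ω² + ω + 1 = 0`. [folklore] -/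
private theorem omega_cube (hω : ω ^ 2 + ω + 1 = 0) : ω ^ 3 = 1 := by
  have h : ω ^ 3 - 1 = (ω - 1) * (ω ^ 2 + ω + 1) := by ring
  rw [hω, mul_zero] at h
  exact sub_eq_zero.1 h

/-- `ω^k = ω^{k mod 3}`. [folklore] -/
private theorem omega_pow_mod (hω : ω ^ 2 + ω + 1 = 0) (k : ℕ) : ω ^ k = ω ^ (k % 3) := by
  conv_lhs => rw [← Nat.div_add_mod k 3, pow_add, pow_mul, omega_cube ω hω, one_pow, one_mul]

/-- `ω^{(a+s).val} = ω^{a.val}·ω^{s.val}` in `ZMod 3` (since `ω³ = 1`). [folklore] -/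
private theorem omega_pow_val_add (hω : ω ^ 2 + ω + 1 = 0) (a s : ZMod 3) :
    ω ^ (a + s).val = ω ^ a.val * ω ^ s.val := by
  rw [ZMod.val_add, ← omega_pow_mod ω hω, pow_add]

/-- The `i`-th factor splits off a product function: `Q_w(y) = (y_i ? w_i : 1) · Π_{j ≠ i} (…)`.
[folklore] -/
private theorem prodFn_eq_mul_prod_erase (w : Fin n → F) (y : Fin n → Bool) (i : Fin n) :
    prodFn w y = (if y i then w i else 1) * ∏ j ∈ univ.erase i, (if y j then w j else 1) := by
  unfold prodFn
  exact (mul_prod_erase univ (fun j => if y j then w j else 1) (mem_univ i)).symm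

/-- **Triads evaluate to zero on the cube.**
[cite: Alon1999, Thm 1.1 — character/group-algebra instance supplied here] -/
theorem cubeEval_triad (hω : ω ^ 2 + ω + 1 = 0) (u : Fin n → ZMod 3) (i : Fin n) :
    cubeEval ω n (triad ω u i) = 0 := by
  have hcube := omega_cube ω hω
  have h1 : ZMod.val (1 : ZMod 3) = 1 := rfl
  have h2 : ZMod.val (2 : ZMod 3) = 2 := rfl
  funext y
  simp only [triad, map_add, map_smul, Pi.add_apply, Pi.smul_apply, smul_eq_mul, cubeEval_single,
    Pi.zero_apply]
  -- split off the `i`-th factor; the remaining product does not depend on the shift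
  have hrest : ∀ s : ZMod 3,
      ∏ j ∈ univ.erase i, (if y j then charVec ω (Function.update u i (u i + s)) j else 1)
        = ∏ j ∈ univ.erase i, (if y j then charVec ω u j else 1) := by
    intro s
    refine prod_congr rfl fun j hj => ?_
    rw [charVec, charVec, Function.update_of_ne (ne_of_mem_erase hj)]
  rw [prodFn_eq_mul_prod_erase (charVec ω u) y i,
    prodFn_eq_mul_prod_erase (charVec ω (Function.update u i (u i + 1))) y i,
    prodFn_eq_mul_prod_erase (charVec ω (Function.update u i (u i + 2))) y i, hrest 1, hrest 2]
  set R := ∏ j ∈ univ.erase i, (if y j then charVec ω u j else 1)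
  -- the one-coordinate identity
  have key : (if y i then charVec ω u i else 1)
      + ω * (if y i then charVec ω (Function.update u i (u i + 1)) i else 1)
      + ω ^ 2 * (if y i then charVec ω (Function.update u i (u i + 2)) i else 1) = 0 := by
    by_cases hy : y i = true
    · simp only [if_pos hy, charVec, Function.update_self]
      rw [omega_pow_val_add ω hω (u i) 1, omega_pow_val_add ω hω (u i) 2, h1, h2]
      linear_combination (ω ^ (u i).val) * hω + (ω ^ (u i).val * ω) * hcube
    · simp only [if_neg hy]
      linear_combination hω
  calc (if y i then charVec ω u i else 1) * R
        + ω * ((if y i then charVec ω (Function.update u i (u i + 1)) i else 1) * R)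
        + ω ^ 2 * ((if y i then charVec ω (Function.update u i (u i + 2)) i else 1) * R)
      = ((if y i then charVec ω u i else 1)
          + ω * (if y i then charVec ω (Function.update u i (u i + 1)) i else 1)
          + ω ^ 2 * (if y i then charVec ω (Function.update u i (u i + 2)) i else 1)) * R := by ring
    _ = 0 := by rw [key, zero_mul]

/-- Triads lie in the kernel of the cube-evaluation map.
[cite: Alon1999, Thm 1.1 — character/group-algebra instance supplied here] -/
theorem triad_mem_ker (hω : ω ^ 2 + ω + 1 = 0) (u : Fin n → ZMod 3) (i : Fin n) :
    triad ω u i ∈ LinearMap.ker (cubeEval ω n) :=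
  LinearMap.mem_ker.2 (cubeEval_triad ω hω u i)

/-- `span(triads) ≤ ker(cubeEval)`.
[cite: Alon1999, Thm 1.1 — character/group-algebra instance supplied here] -/
theorem span_triad_le_ker (hω : ω ^ 2 + ω + 1 = 0) :
    triadSpan ω n
      ≤ LinearMap.ker (cubeEval ω n) := by
  rw [Submodule.span_le]
  rintro _ ⟨⟨u, i⟩, rfl⟩
  exact triad_mem_ker ω hω u i

/-! ### §3 Reduction to Boolean-valued exponents modulo triads -/

/-- The coefficient vectors supported on `{0,1}`-valued exponent vectors (`u i ≠ 2` for all `i`)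
— the remainders of the Nullstellensatz division (degree `< 2` in each `z_i`).
[cite: Alon1999, Thm 1.1 — character/group-algebra instance supplied here] -/
def boolSupp (n : ℕ) : Submodule F ((Fin n → ZMod 3) → F) where
  carrier := {a | ∀ v : Fin n → ZMod 3, (∃ i, v i = 2) → a v = 0}
  zero_mem' := fun _ _ => rfl
  add_mem' := by
    intro a b ha hb v hv
    simp only [Pi.add_apply, ha v hv, hb v hv, add_zero]
  smul_mem' := by
    intro c a ha v hv
    simp only [Pi.smul_apply, smul_eq_mul, ha v hv, mul_zero]

/-- Membership in `boolSupp`.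
[cite: Alon1999, Thm 1.1 — character/group-algebra instance supplied here] -/
theorem mem_boolSupp {a : (Fin n → ZMod 3) → F} :
    a ∈ boolSupp (F := F) n ↔ ∀ v : Fin n → ZMod 3, (∃ i, v i = 2) → a v = 0 := Iff.rfl

/-- A basis vector `[v]` with `v ∈ {0,1}ⁿ` lies in `boolSupp`.
[cite: Alon1999, Thm 1.1 — character/group-algebra instance supplied here] -/
theorem single_mem_boolSupp {v : Fin n → ZMod 3} (hv : ∀ i, v i ≠ 2) :
    (Pi.single v (1 : F) : (Fin n → ZMod 3) → F) ∈ boolSupp (F := F) n := by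
  intro w hw
  obtain ⟨i, hi⟩ := hw
  have hne : w ≠ v := fun h => hv i (h ▸ hi)
  simp [hne]

/-- The triad with base point `v[i ↦ 0]`, written out: `[v[i↦0]] + ω·[v[i↦1]] + ω²·[v[i↦2]]`.
[folklore] -/
private theorem triad_update_zero (v : Fin n → ZMod 3) (i : Fin n) :
    triad ω (Function.update v i 0) i
      = Pi.single (Function.update v i 0) (1 : F) + ω • Pi.single (Function.update v i 1) (1 : F)
        + ω ^ 2 • Pi.single (Function.update v i 2) (1 : F) := by
  simp only [triad, Function.update_self, zero_add, Function.update_idem]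

/-- **Reduction step.**  If `v_i = 2` then
`[v] = ω·triad(v[i↦0], i) − ω·[v[i↦0]] − ω²·[v[i↦1]]` (using `ω³ = 1`).
[cite: Alon1999, Thm 1.1 (division with remainder by `g_i`) — character form supplied here] -/
theorem single_eq_of_apply_eq_two (hω : ω ^ 2 + ω + 1 = 0) {v : Fin n → ZMod 3} {i : Fin n}
    (hi : v i = 2) :
    (Pi.single v (1 : F) : (Fin n → ZMod 3) → F)
      = ω • triad ω (Function.update v i 0) i - ω • Pi.single (Function.update v i 0) (1 : F)
        - ω ^ 2 • Pi.single (Function.update v i 1) (1 : F) := by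
  have hv : Function.update v i 2 = v := by rw [← hi, Function.update_eq_self]
  rw [triad_update_zero, hv, smul_add, smul_add, smul_smul, smul_smul, ← sq, ← pow_succ',
    show (2 : ℕ) + 1 = 3 from rfl, omega_cube ω hω, one_smul]
  abel

/-- Every basis vector `[v]` lies in `span(triads) ⊔ boolSupp` (induction on the number of
coordinates of `v` equal to `2`).
[cite: Alon1999, Thm 1.1 — character/group-algebra instance supplied here] -/
theorem single_mem_span_triad_sup_boolSupp (hω : ω ^ 2 + ω + 1 = 0) (v : Fin n → ZMod 3) :
    (Pi.single v (1 : F) : (Fin n → ZMod 3) → F)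
      ∈ triadSpan ω n
          ⊔ boolSupp (F := F) n := by
  -- induction on `k ≥ #{i : v i = 2}`
  suffices h : ∀ k : ℕ, ∀ v : Fin n → ZMod 3, (univ.filter fun i => v i = 2).card ≤ k →
      (Pi.single v (1 : F) : (Fin n → ZMod 3) → F)
        ∈ triadSpan ω n
            ⊔ boolSupp (F := F) n from h _ v le_rfl
  intro k
  induction k with
  | zero =>
      intro v hv
      have hv' : ∀ i, v i ≠ 2 := by
        intro i hi
        have : i ∈ univ.filter fun j => v j = 2 := mem_filter.2 ⟨mem_univ i, hi⟩
        rw [Nat.le_zero, card_eq_zero] at hv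
        rw [hv] at this
        exact absurd this (notMem_empty i)
      exact Submodule.mem_sup_right (single_mem_boolSupp hv')
  | succ k ih =>
      intro v hv
      by_cases hle : (univ.filter fun i => v i = 2).card ≤ k
      · exact ih v hle
      · -- pick a coordinate equal to `2`
        have hpos : 0 < (univ.filter fun i => v i = 2).card := by omega
        obtain ⟨i, hi⟩ := card_pos.1 hpos
        have hvi : v i = 2 := (mem_filter.1 hi).2
        -- the two lower vectors have fewer `2`s
        have hlow : ∀ c : ZMod 3, c ≠ 2 →
            (univ.filter fun j => Function.update v i c j = 2).card ≤ k := by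
          intro c hc
          have hsub : (univ.filter fun j => Function.update v i c j = 2)
              ⊆ (univ.filter fun j => v j = 2).erase i := by
            intro j hj
            rw [mem_filter] at hj
            rw [mem_erase, mem_filter]
            by_cases hji : j = i
            · subst hji; rw [Function.update_self] at hj; exact absurd hj.2 hc
            · rw [Function.update_of_ne hji] at hj; exact ⟨hji, mem_univ j, hj.2⟩
          have := card_le_card hsub
          rw [card_erase_of_mem hi] at this
          omega
        have h0 := ih _ (hlow 0 (by decide))
        have h1 := ih _ (hlow 1 (by decide))
        have ht : triad ω (Function.update v i 0) i
            ∈ triadSpan ω n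
                ⊔ boolSupp (F := F) n :=
          Submodule.mem_sup_left (Submodule.subset_span ⟨(Function.update v i 0, i), rfl⟩)
        rw [single_eq_of_apply_eq_two ω hω hvi]
        exact Submodule.sub_mem _ (Submodule.sub_mem _ (Submodule.smul_mem _ _ ht)
          (Submodule.smul_mem _ _ h0)) (Submodule.smul_mem _ _ h1)

/-- `span(triads) ⊔ boolSupp = ⊤`: modulo triads every coefficient vector is congruent to one
supported on `{0,1}ⁿ`.
[cite: Alon1999, Thm 1.1 — character/group-algebra instance supplied here] -/
theorem span_triad_sup_boolSupp_eq_top (hω : ω ^ 2 + ω + 1 = 0) :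
    triadSpan ω n
        ⊔ boolSupp (F := F) n = ⊤ := by
  rw [Submodule.eq_top_iff']
  intro a
  have ha : a = ∑ v, a v • (Pi.single v (1 : F) : (Fin n → ZMod 3) → F) := by
    funext w
    simp [Finset.sum_apply, Pi.single_apply]
  rw [ha]
  exact Submodule.sum_mem _ fun v _ =>
    Submodule.smul_mem _ _ (single_mem_span_triad_sup_boolSupp ω hω v)

/-! ### §4 Injectivity on Boolean-supported vectors: the tensor functional -/

/-- One-coordinate weights of the separating functional: for target value `c = 1` the weights
`(true ↦ 1, false ↦ −1)` (kills `ω^0`, keeps `ω^1`), otherwise `(true ↦ −1, false ↦ ω)` (kills `ω^1`,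
keeps `ω^0`).  (Dual-basis bookkeeping for the linear independence of the `Q[u]`, `u ∈ {0,1}ⁿ`.)
[cite: Alon1999, Thm 1.1 — character/group-algebra instance supplied here] -/
def sepWeight (c : ZMod 3) (b : Bool) : F :=
  if c = 1 then (if b then 1 else -1) else (if b then -1 else ω)

/-- The one-coordinate pairing `Σ_b sepWeight(c, b)·(b ? ω^{e} : 1)`. [folklore] -/
private theorem sum_sepWeight_mul (c e : ZMod 3) :
    ∑ b : Bool, sepWeight ω c b * (if b then ω ^ e.val else 1)
      = if c = 1 then ω ^ e.val - 1 else ω - ω ^ e.val := by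
  rw [Fintype.sum_bool]
  by_cases hc : c = 1 <;> simp [sepWeight, hc] <;> ring

/-- For Boolean-valued `c, e ∈ {0,1}`: the one-coordinate pairing is `ω − 1 ≠ 0` if `e = c` and `0`
otherwise. [folklore] -/
private theorem sum_sepWeight_mul_bool {c e : ZMod 3} (hc : c ≠ 2) (he : e ≠ 2) :
    ∑ b : Bool, sepWeight ω c b * (if b then ω ^ e.val else 1) = if e = c then ω - 1 else 0 := by
  rw [sum_sepWeight_mul]
  have hc' : c = 0 ∨ c = 1 := by revert hc; decide +revert
  have he' : e = 0 ∨ e = 1 := by revert he; decide +revert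
  have h1 : (1 : ZMod 3).val = 1 := rfl
  have h0 : (0 : ZMod 3).val = 0 := rfl
  rcases hc' with rfl | rfl <;> rcases he' with rfl | rfl <;> simp [h0, h1]

/-- **The separating functional** `Λ_{v₀}(g) = Σ_y (Π_i sepWeight(v₀ i, y i))·g(y)` on a product
function: `Λ_{v₀}(Q[u]) = Π_i Σ_b sepWeight(v₀ i, b)·(b ? ω^{u_i} : 1)`.
[cite: Alon1999, Thm 1.1 — character/group-algebra instance supplied here] -/
theorem sum_sepWeight_prodFn (v₀ u : Fin n → ZMod 3) :
    ∑ y : Fin n → Bool, (∏ i, sepWeight ω (v₀ i) (y i)) * prodFn (charVec ω u) y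
      = ∏ i, ∑ b : Bool, sepWeight ω (v₀ i) b * (if b then ω ^ (u i).val else 1) := by
  rw [prod_univ_sum, Fintype.piFinset_univ]
  refine sum_congr rfl fun y _ => ?_
  rw [prodFn, ← prod_mul_distrib]
  rfl

/-- For Boolean-valued `v₀, u`: `Λ_{v₀}(Q[u]) = (ω − 1)ⁿ·[u = v₀]`.
[cite: Alon1999, Thm 1.1 — character/group-algebra instance supplied here] -/
theorem sum_sepWeight_prodFn_bool {v₀ u : Fin n → ZMod 3}
    (hv₀ : ∀ i, v₀ i ≠ 2) (hu : ∀ i, u i ≠ 2) :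
    ∑ y : Fin n → Bool, (∏ i, sepWeight ω (v₀ i) (y i)) * prodFn (charVec ω u) y
      = if u = v₀ then (ω - 1) ^ n else 0 := by
  rw [sum_sepWeight_prodFn]
  simp_rw [sum_sepWeight_mul_bool ω (hv₀ _) (hu _)]
  by_cases huv : u = v₀
  · subst huv
    simp
  · rw [if_neg huv]
    obtain ⟨i, hi⟩ : ∃ i, u i ≠ v₀ i := by
      by_contra h
      push Not at h
      exact huv (funext h)
    exact prod_eq_zero (mem_univ i) (if_neg hi)

/-- **`cubeEval` is injective on Boolean-supported coefficient vectors** (for `ω ≠ 1`; the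
hypothesis `ω² + ω + 1 = 0` is not needed here: the characters `Q[u]`, `u ∈ {0,1}ⁿ`, are linearly
independent on the cube as soon as `ω ≠ 1`).
[cite: Alon1999, Thm 1.1 — character/group-algebra instance supplied here] -/
theorem eq_zero_of_mem_boolSupp_of_cubeEval_eq_zero (hω1 : ω ≠ 1)
    {a : (Fin n → ZMod 3) → F} (ha : a ∈ boolSupp (F := F) n) (h0 : cubeEval ω n a = 0) :
    a = 0 := by
  funext v₀
  by_cases hv₀ : ∃ i, v₀ i = 2
  · exact ha v₀ hv₀
  push Not at hv₀
  -- apply the functional `Λ_{v₀}` to `cubeEval a = 0`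
  have hΛ : ∑ y : Fin n → Bool, (∏ i, sepWeight ω (v₀ i) (y i)) * cubeEval ω n a y = 0 := by
    rw [h0]; simp
  simp_rw [cubeEval_apply, mul_sum] at hΛ
  rw [sum_comm] at hΛ
  have hterm : ∀ u : Fin n → ZMod 3,
      ∑ y : Fin n → Bool, (∏ i, sepWeight ω (v₀ i) (y i)) * (a u * prodFn (charVec ω u) y)
        = a u * (if u = v₀ then (ω - 1) ^ n else 0) := by
    intro u
    by_cases hu : ∃ i, u i = 2
    · rw [ha u hu]; simp
    · push Not at hu
      rw [← sum_sepWeight_prodFn_bool ω hv₀ hu, mul_sum]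
      exact sum_congr rfl fun y _ => by ring
  simp_rw [hterm] at hΛ
  rw [sum_eq_single_of_mem v₀ (mem_univ v₀) (fun u _ hu => by rw [if_neg hu, mul_zero]),
    if_pos rfl] at hΛ
  have hne : (ω - 1) ^ n ≠ 0 := pow_ne_zero _ (sub_ne_zero.2 hω1)
  simpa [hne] using hΛ

/-- `ker(cubeEval) ⊓ boolSupp = ⊥`.
[cite: Alon1999, Thm 1.1 — character/group-algebra instance supplied here] -/
theorem ker_inf_boolSupp_eq_bot (hω1 : ω ≠ 1) :
    LinearMap.ker (cubeEval ω n) ⊓ boolSupp (F := F) n = ⊥ := by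
  rw [Submodule.eq_bot_iff]
  intro a ha
  exact eq_zero_of_mem_boolSupp_of_cubeEval_eq_zero ω hω1 ha.2 (LinearMap.mem_ker.1 ha.1)

/-! ### §5 The triad kernel theorem -/

/-- **TRIAD KERNEL.**  For `ω² + ω + 1 = 0`, `ω ≠ 1`: the kernel of the cube-evaluation map
`Σ_u a(u)[u] ↦ (y ↦ Σ_u a(u)·ω^{⟨u,y⟩})` on `F[(ℤ/3)ⁿ]` is the span of the triads
`Σ_s ω^s [u + s e_i]`.
[cite: Alon1999, Thm 1.1 (polynomials vanishing on the grid `{1,ω}ⁿ` lie in the ideal of the `(z_i − 1)(z_i − ω)`) — character/group-algebra form supplied here] -/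
theorem ker_cubeEval_eq_span_triad (hω : ω ^ 2 + ω + 1 = 0) (hω1 : ω ≠ 1) :
    LinearMap.ker (cubeEval ω n)
      = triadSpan ω n := by
  refine le_antisymm ?_ (span_triad_le_ker ω hω)
  intro a ha
  have htop := span_triad_sup_boolSupp_eq_top ω hω (n := n)
  have ha' : a ∈ triadSpan ω n
      ⊔ boolSupp (F := F) n := by rw [htop]; exact Submodule.mem_top
  obtain ⟨t, ht, b, hb, htb⟩ := Submodule.mem_sup.1 ha'
  have hbker : b ∈ LinearMap.ker (cubeEval ω n) := by
    have : b = a - t := by rw [← htb]; abel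
    rw [this]
    exact Submodule.sub_mem _ ha (span_triad_le_ker ω hω ht)
  have hb0 : b = 0 :=
    eq_zero_of_mem_boolSupp_of_cubeEval_eq_zero ω hω1 hb (LinearMap.mem_ker.1 hbker)
  rw [← htb, hb0, add_zero]
  exact ht

/-- The characteristic-`2` reading (the cell's `𝔽₄ ∋ ω`): `ω ≠ 1` is automatic.
[cite: Alon1999, Thm 1.1 — character/group-algebra form supplied here] -/
theorem ker_cubeEval_eq_span_triad_of_charTwo [CharP F 2] (hω : ω ^ 2 + ω + 1 = 0) :
    LinearMap.ker (cubeEval ω n)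
      = triadSpan ω n := by
  refine ker_cubeEval_eq_span_triad ω hω ?_
  intro h1
  rw [h1, one_pow] at hω
  have h2 : (2 : F) = 0 := CharP.cast_eq_zero F 2 ▸ by norm_num
  have : (1 : F) = 0 := by linear_combination hω - h2
  exact one_ne_zero this

/-- **Boolean normal form.**  `span(triads)` and `boolSupp` are complementary: every coefficient
vector is congruent modulo triads to a UNIQUE vector supported on `{0,1}ⁿ`-valued exponents.
[cite: Alon1999, Thm 1.1 (unique remainder of degree `< |S_i|` in each variable) — character form supplied here] -/
theorem isCompl_span_triad_boolSupp (hω : ω ^ 2 + ω + 1 = 0) (hω1 : ω ≠ 1) :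
    IsCompl (triadSpan ω n)
      (boolSupp (F := F) n) := by
  refine ⟨?_, ?_⟩
  · rw [disjoint_iff, ← le_bot_iff, ← ker_inf_boolSupp_eq_bot ω hω1]
    exact inf_le_inf_right _ (span_triad_le_ker ω hω)
  · rw [codisjoint_iff]
    exact span_triad_sup_boolSupp_eq_top ω hω

/-- Injectivity of `cubeEval` on Boolean-supported vectors, stated positively: two Boolean-supported
coefficient vectors with the same cube function are equal (the `{0,1}`-exponent characters
`Q[u]`, `u ∈ {0,1}ⁿ`, are linearly independent on the cube).
[cite: Alon1999, Thm 1.1 — character/group-algebra form supplied here] -/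
theorem cubeEval_injOn_boolSupp (hω1 : ω ≠ 1)
    {a b : (Fin n → ZMod 3) → F} (ha : a ∈ boolSupp (F := F) n) (hb : b ∈ boolSupp (F := F) n)
    (h : cubeEval ω n a = cubeEval ω n b) : a = b := by
  have h0 : cubeEval ω n (a - b) = 0 := by rw [map_sub, h, sub_self]
  exact sub_eq_zero.1
    (eq_zero_of_mem_boolSupp_of_cubeEval_eq_zero ω hω1 (Submodule.sub_mem _ ha hb) h0)

/-! ### §6 Relation form -/

/-- The coefficient vector of an indexed family of characters: `u ↦ Σ_{j ∈ J : w j = u} a j`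
(the group-algebra element `Σ_j a_j [w_j]`).
[cite: Alon1999, Thm 1.1 — character/group-algebra instance supplied here] -/
def fiberCoeff {ι : Type*} (J : Finset ι) (a : ι → F) (w : ι → (Fin n → ZMod 3)) :
    (Fin n → ZMod 3) → F :=
  fun u => ∑ j ∈ J.filter (fun j => w j = u), a j

/-- The cube function of an indexed combination of characters is `cubeEval` of its coefficient
vector.
[cite: Alon1999, Thm 1.1 — character/group-algebra form supplied here] -/
theorem cubeEval_fiberCoeff {ι : Type*} (J : Finset ι) (a : ι → F) (w : ι → (Fin n → ZMod 3))
    (y : Fin n → Bool) :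
    cubeEval ω n (fiberCoeff J a w) y = ∑ j ∈ J, a j * prodFn (charVec ω (w j)) y := by
  rw [cubeEval_apply]
  simp only [fiberCoeff, sum_mul]
  rw [← sum_fiberwise_of_maps_to (s := J) (t := (univ : Finset (Fin n → ZMod 3))) (g := w)
    (fun j _ => mem_univ _)]
  refine sum_congr rfl fun u _ => sum_congr rfl fun j hj => ?_
  rw [(mem_filter.1 hj).2]

/-- **Relation form of the triad kernel.**  If `Σ_{j ∈ J} a_j·Q[w_j] ≡ 0` on the cube, the
coefficient vector `u ↦ Σ_{j : w_j = u} a_j` is a linear combination of triads.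
[cite: Alon1999, Thm 1.1 — character/group-algebra form supplied here] -/
theorem fiberCoeff_mem_span_triad_of_rel (hω : ω ^ 2 + ω + 1 = 0) (hω1 : ω ≠ 1) {ι : Type*}
    (J : Finset ι) (a : ι → F) (w : ι → (Fin n → ZMod 3))
    (hrel : ∀ y : Fin n → Bool, ∑ j ∈ J, a j * prodFn (charVec ω (w j)) y = 0) :
    fiberCoeff J a w
      ∈ triadSpan ω n := by
  rw [← ker_cubeEval_eq_span_triad ω hω hω1, LinearMap.mem_ker]
  funext y
  rw [cubeEval_fiberCoeff, hrel y]
  rfl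

/-- Conversely, every combination of triads is a relation on the cube.
[cite: Alon1999, Thm 1.1 — character/group-algebra form supplied here] -/
theorem cubeEval_eq_zero_of_mem_span_triad (hω : ω ^ 2 + ω + 1 = 0) {a : (Fin n → ZMod 3) → F}
    (ha : a ∈ triadSpan ω n) :
    cubeEval ω n a = 0 :=
  LinearMap.mem_ker.1 (span_triad_le_ker ω hω ha)

end CubeCharacters

end ProductSpan

end Literature.Computability.MetaComplexity
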